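import Summits.HodgeConjecture.HodgeConjecture.Theorems.WeilTypeLadderBlochSeed
import HarnessLib

/-!
# Venture HSemireg — LEVERAGE, per `d`: one semiregular representative on a SPLIT anchor one dimension UP settles
# EVERY `√-d`-Weil abelian `2n`-fold of that `d` (split AND non-split components)

HONEST FRAMING. Lean index of the computation cell `pub-hsemireg`; nothing about any explicit variety is asserted; every
published input is a hypothesis BY NAME; no new definition. `Transfer.lean` / `SheafSeed.lean` record what one seed at one
anchor gives on the anchor's OWN component. This file records, PER `d` (the shape one computation at one `d` closes), the
tree's degeneration edge one dimension up: the Hodge summit's `stub_descend n d` —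
`Stubs.WeilAlgebraicSplitHyperplane (n+1) d → WeilAlgebraicAll n d` for `n ≥ 2`, `d ≥ 1`, PROVED in the tree
(`…StubDescendPrym.lean`: partner Weil-type surfaces of complementary discriminant, van Geemen 5.5, so that `A × S` is
split; Schoen's transfer `W(A × S)` algebraic ⟹ `W(A)` algebraic, Compositio 114 §10; both halves discharged) — composed
with the split-component engine from ONE locally algebraic hyperbolic anchor (`weilClasses_algebraic_hyperbolic_of_localAnchor`,
Deligne's reach `weilFamilyReach_hyperbolic`, REFEREED named fact) and the Bloch feeder
(`hasLocallyAlgebraicWeilAnchor_of_blochSpread_of_hyperbolicBlochSeed`, transport `BlochSemiregularSpread`, REFEREED named fact).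

* `weilAlgebraicAll_of_localAnchor_succ` — `n ≥ 2`, `d ≥ 1`: reach ∧ `HasLocallyAlgebraicWeilAnchor (n+1) d` ⟹
  `WeilAlgebraicAll n d` (every rational `(n,n)` Weil class on every `√-d`-Weil `2n`-fold is algebraic).
* `weilAlgebraicAll_of_hyperbolic_seed_succ` — the same from `BlochSemiregularSpread (2(n+1)) (n+1)` and ONE hyperbolic
  Bloch seed `HasHyperbolicBlochSeed (n+1) d` (an integral Bloch-semiregular lci `(n+1)`-fold on a split `2(n+1)`-fold,
  e.g. the CM point `E^{2n+2}`).
* `weilSixfolds_slice_of_eightfold_seed` — `n = 3`: ONE seed on a split EIGHTFOLD (e.g. `E⁸`) at `d` ⟹ ALL `√-d`-Weil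
  SIXFOLDS at `d`, every discriminant — the cell's Prong B target, per `d`. (The tree's all-`d` form is
  `WeilTypeLadder.weilSixfolds_of_reach_of_blochSpread_of_seeds_four`.)
* `weilFourfolds_slice_of_sixfold_seed` — `n = 2`: one seed on a split SIXFOLD at `d` ⟹ all `√-d`-Weil FOURFOLDS at `d`
  (Markman's fourfold theorem at that `d`, all discriminants, by Bloch's route).

References: [Schoen1998HodgeWeilAddendum] C. Schoen, Compositio Math. 114 (1998), §10; [vanGeemen1994HodgeAV] 5.5;
[Deligne1982HodgeCycles] proof of Thm. 4.8; [Bloch1972Semiregularity] Thm. (7.4), Remark (7.5);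
[Markman2025SurveySecant] §11.5 Step 2 (the printed pattern one dimension down).
-/

noncomputable section

open CategoryTheory AlgebraicGeometry

namespace Summit.Ventures.HSemireg

open Literature.AlgebraicGeometry Literature.AlgebraicGeometry.Motives
open Literature.AlgebraicGeometry.HodgeTheory
open Literature.AlgebraicTopology.SingularHomology
open Summit.HodgeConjecture.HodgeConjecture.WeilTypeLadder
open Summit.HodgeConjecture.HodgeConjecture.Cruxes.HodgeAbelianVarieties.EStepSecantInduction
open Summit.HodgeConjecture.HodgeConjecture.Cruxes.HodgeAbelianVarieties.PrymCanonicalZ3SplitSeeds.Stubs.Descend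
  (stub_descend)

/-- **Per `d`: a locally algebraic hyperbolic anchor one dimension UP settles every `√-d`-Weil `2n`-fold** (`n ≥ 2`,
`d ≥ 1`; hypotheses BY NAME): Deligne's hyperbolic reach (`weilFamilyReach_hyperbolic`, refereed named fact) and
`HasLocallyAlgebraicWeilAnchor (n+1) d` give the split sector `Stubs.WeilAlgebraicSplitHyperplane (n+1) d`
(`weilClasses_algebraic_hyperbolic_of_localAnchor`), and the tree's PROVED degeneration edge `stub_descend` (partner
surfaces + Schoen's product transfer) brings it down to ALL `2n`-folds of that `d`: `WeilAlgebraicAll n d`.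
[cite: Schoen1998HodgeWeilAddendum, §10] [cite: Deligne1982HodgeCycles, proof of Thm. 4.8] [cite: vanGeemen1994HodgeAV, 5.5] -/
theorem weilAlgebraicAll_of_localAnchor_succ (n d : ℕ) (hn : 2 ≤ n) (hd : 0 < d) (hF : weilFamilyReach_hyperbolic)
    (hL : HasLocallyAlgebraicWeilAnchor (n + 1) d) : WeilAlgebraicAll n d := by
  refine stub_descend n d hn hd ?_
  intro B ψ e a hB hψ ha ha0 hhyp c hcW hc hH
  exact weilClasses_algebraic_hyperbolic_of_localAnchor (n + 1) d (by omega) hd hL hF B ψ hB hψ e a ha ha0 hhyp hcW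

/-- **Per `d`: ONE hyperbolic Bloch seed one dimension UP settles every `√-d`-Weil `2n`-fold** (`n ≥ 2`, `d ≥ 1`):
`BlochSemiregularSpread (2(n+1)) (n+1)` (Bloch (7.4)/(7.5) = BF Thm. 5.2, refereed named fact) ∧ reach ∧
`HasHyperbolicBlochSeed (n+1) d` ⟹ `WeilAlgebraicAll n d`. [cite: Bloch1972Semiregularity, Thm. (7.4) and Remark (7.5)]
[cite: Schoen1998HodgeWeilAddendum, §10] [cite: Deligne1982HodgeCycles, proof of Thm. 4.8] -/
theorem weilAlgebraicAll_of_hyperbolic_seed_succ (n d : ℕ) (hn : 2 ≤ n) (hd : 0 < d)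
    (hB : BlochSemiregularSpread (2 * (n + 1)) (n + 1)) (hF : weilFamilyReach_hyperbolic)
    (hS : HasHyperbolicBlochSeed (n + 1) d) : WeilAlgebraicAll n d :=
  weilAlgebraicAll_of_localAnchor_succ n d hn hd hF
    (hasLocallyAlgebraicWeilAnchor_of_blochSpread_of_hyperbolicBlochSeed hB hS)

/-- **Prong B, per `d`: one integral Bloch-semiregular lci FOURFOLD on a split `√-d`-Weil EIGHTFOLD (e.g. the CM point
`E⁸`) ⟹ every rational `(3,3)` Weil class on every `√-d`-Weil abelian SIXFOLD is algebraic — split and non-split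
components alike.** [cite: Bloch1972Semiregularity, Thm. (7.4) and Remark (7.5)] [cite: Schoen1998HodgeWeilAddendum, §10]
[cite: Markman2025SurveySecant, §11.5 Step 2] -/
theorem weilSixfolds_slice_of_eightfold_seed (d : ℕ) (hd : 0 < d) (hB : BlochSemiregularSpread 8 4)
    (hF : weilFamilyReach_hyperbolic) (hS : HasHyperbolicBlochSeed 4 d) : WeilAlgebraicAll 3 d :=
  weilAlgebraicAll_of_hyperbolic_seed_succ 3 d (by norm_num) hd hB hF hS

/-- **Per `d`: one integral Bloch-semiregular lci THREEFOLD on a split `√-d`-Weil SIXFOLD (e.g. `E⁶`) ⟹ every rational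
`(2,2)` Weil class on every `√-d`-Weil abelian FOURFOLD is algebraic** (all discriminants: Markman's fourfold theorem at
this `d`, by Bloch's route). [cite: Bloch1972Semiregularity, Thm. (7.4) and Remark (7.5)]
[cite: Schoen1998HodgeWeilAddendum, §10] [cite: Markman2025SurveySecant, §11.5 Step 2] -/
theorem weilFourfolds_slice_of_sixfold_seed (d : ℕ) (hd : 0 < d) (hB : BlochSemiregularSpread 6 3)
    (hF : weilFamilyReach_hyperbolic) (hS : HasHyperbolicBlochSeed 3 d) : WeilAlgebraicAll 2 d :=
  weilAlgebraicAll_of_hyperbolic_seed_succ 2 d le_rfl hd hB hF hS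

/-- Unfolding `WeilAlgebraicAll n d` (the tree's predicate, for the record of this index): every rational class of Hodge
type `(n,n)` in the Weil plane of every complex abelian `2n`-fold `(A, φ)` with `φ ≫ φ = -(d • 𝟙 A)` is algebraic.
[cite: vanGeemen1994HodgeAV, §5.2] -/
theorem weilAlgebraicAll_iff (n d : ℕ) :
    WeilAlgebraicAll n d ↔ ∀ (A : AbelianVariety ℂ) (φ : A ⟶ A), A.dim = 2 * n → φ ≫ φ = -(d • 𝟙 A) →
      ∀ c ∈ weilClassesOf A φ n d, IsRationalClass c → IsOfHodgeType (2 * n) A.X (2 * n) n n c →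
        c ∈ algebraicClasses A.X n :=
  Iff.rfl

end Summit.Ventures.HSemireg

end
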